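import Mathlib
import Literature.Analysis.FluidPDE.HardSphereCollisionRecord
import Literature.MathematicalPhysics.KineticTheory.HardSphereEuler
import Literature.MathematicalPhysics.KineticTheory.HardSphereEulerProofs
import HarnessLib

/-!
# `OneFlightGossipEngine.OneFlightLayeredChaos` — the three inputs of line `Sketch`, restated THESES-FREE
(crux stmt-AtomisticToContinuum-14535, line `Sketch`, lead cycle c4, brick B4; registered stub `shortGapSet_mono`)

The line `Sketch` reduced the crux `Theses.OneFlightGossipEngine.OneFlightLayeredChaos` to three typed inputs, all
`def … : Prop` of the frame `Theorems.OLC`: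

* `OLC.FirstFlightGhostInput θ₀` (`…OneFlightLayeredChaosFirstFlightGhostInput.lean`) — the FIRST RUNG in ghost form
  (conditional Stosszahlansatz of one tagged pair against the equilibrium ghost environment, velocities frozen,
  positions hard-core uniform, the `(N+1)`-body flow removed);
* `OLC.RegimeTransQuasiInvBody θ₀ X` (`…OneFlightLayeredChaosTransQuasiInv.lean`) — event-level translation
  quasi-invariance, given the coarse past, of the transverse offset of the colliding pair at the later flight start —
  on the SHORT-GAP regime `X = (OLC.shortGap θ₀ (1/20)).inter (OLC.shortGap θ₀ 0).compl` and on the LONG-GAP regime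
  `X = (OLC.shortGap θ₀ (1/20)).compl` (or, the two merged, on the NONZERO-GAP regime `X = (OLC.shortGap θ₀ 0).compl`);

and the glue `OLC.oneFlightLayeredChaos_of_inputs` / `OLC.oneFlightLayeredChaos_of_two_inputs`
(`…OneFlightLayeredChaosSplitGlue.lean`) proves the crux BY NAME from them.

WHY THIS FILE. All those `OLC` modules import the route's Theses file
`Summits.AtomisticToContinuum.HydrodynamicLimit.Theses.OneFlightGossipEngine` (through `…Regimes.lean`), so the Theses
file cannot refer to the inputs when they are promoted to statement items (import cycle). This file RESTATES the
inputs with NO `Summits` import at all: every `OLC` notion they mention (`rhoStar σ = (√2 π σ²)⁻¹`,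
`mfTime σ θ₀ N = (N+1)^{-1/3}/(σ² √θ₀)`, `freeEntranceTime`, `firstFlightGhostEvent`, `RegimeTransQuasiInvTail`,
`Regime`, `Regime.inter`, `Regime.compl`, `shortGap`) is INLINED VERBATIM down to `Literature`/Mathlib vocabulary, so
that each restatement is DEFINITIONALLY EQUAL to the corresponding `OLC` input; the `Iff.rfl`/`rfl` bridges and the
glue over the restatements (`OLC.oneFlightLayeredChaos_of_thesesFreeInputs`, `…_of_thesesFreeTwoInputs`) are
`…OneFlightLayeredChaosInputsGlue.lean`.

* `Inputs.FirstRungAt θ₀` ≡ `OLC.FirstFlightGhostInput θ₀`;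
* `Inputs.TransQuasiInvAt θ₀ X` ≡ `OLC.RegimeTransQuasiInvBody θ₀ X` (the regime type `OLC.Regime` written out);
* `Inputs.shortGapSet θ₀ u₀` ≡ `OLC.shortGap θ₀ u₀` (the short-gap regime `{|s_i − s_j| ≤ u₀ · mfTime}`);
* `Inputs.ShortGapAt θ₀` ≡ `OLC.RegimeTransQuasiInvBody θ₀ ((OLC.shortGap θ₀ (1/20)).inter (OLC.shortGap θ₀ 0).compl)`,
  `Inputs.LongGapAt θ₀` ≡ `OLC.RegimeTransQuasiInvBody θ₀ (OLC.shortGap θ₀ (1/20)).compl`,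
  `Inputs.NonzeroGapAt θ₀` ≡ `OLC.RegimeTransQuasiInvBody θ₀ (OLC.shortGap θ₀ 0).compl` — `TransQuasiInvAt θ₀` on the
  three regimes;
* `shortGapSet_mono` (registered stub) — the short-gap regimes are nested in the cut `u₀` (the file's carrier theorem).

The three inputs of the line are then the texts `∀ θ₀ : ℝ, 0 < θ₀ → Inputs.FirstRungAt θ₀`,
`∀ θ₀ : ℝ, 0 < θ₀ → Inputs.ShortGapAt θ₀`, `∀ θ₀ : ℝ, 0 < θ₀ → Inputs.LongGapAt θ₀` (merged form:
`∀ θ₀ : ℝ, 0 < θ₀ → Inputs.NonzeroGapAt θ₀`), statable in the Theses file. Every proposition here is PARAMETRISED (by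
the temperature `θ₀`, as the `OLC` originals): the closed statements are for the route's Theses file to declare as
items, not for a Theorems file. These are typed HYPOTHESES of the line (named predicates the route posits; nothing is
asserted, they are not published facts). Deliberately NOT here: any API or theorem about the inputs (those live with
the `OLC` originals), any new notion.
-/

open scoped BigOperators ENNReal Topology
open MeasureTheory Set Filter
open Literature.Analysis.FluidPDE Literature.MathematicalPhysics.KineticTheory

namespace Summit.AtomisticToContinuum.HydrodynamicLimit.Theorems.OLC.Inputs

noncomputable section

/-! ## The first rung (ghost form) -/

/-- **First rung at temperature `θ₀`, Theses-free** — the text of `OLC.FirstFlightGhostInput θ₀` with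
`OLC.rhoStar σ` replaced by `(√2 π σ²)⁻¹`, the entrance time `OLC.freeEntranceTime ε z i j` of the two free flights by
its body `sInf {t > 0 | ‖sepVec (x_i + t v_i) (x_j + t v_j)‖ ≤ ε}` (junk `0`), and the ghost event
`OLC.firstFlightGhostEvent Ψ i j emb w` by its set-builder body (`z ∘ emb` is `Ψ`-good, the entrance time lies in
`(0, w]`, and during `(0, t⋆]` every ghost particle stays at distance `> ε` from both free flights); so
`FirstRungAt θ₀ ↔ OLC.FirstFlightGhostInput θ₀` is `Iff.rfl` (`OLC.Inputs.firstRungAt_iff`); the first input of the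
line is `∀ θ₀ > 0, FirstRungAt θ₀` (the registered stub `stub_firstFlight_ghostInput` of the skeleton
`Lines/Sketch.lean`). Content: velocities frozen (`γ = ⊗ gauss(0, θ₀)`), positions hard-core uniform
(`μ = posGibbsMeasure 1 ε (N+1)`), fixed pair `j ≠ i`,
window `w = τ (N+1)^{-1/3}`, cells of mesh `ρ⋆(σ)(N+1)^{-1/3}`: on the ghost event `F` the contact normal
`ω = ε⁻¹ sepVec (x_i + t⋆ v_i) (x_j + t⋆ v_j)` has, jointly with the cells, the flux law of direction `ĝ = (v_i − v_j)/‖·‖`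
up to a weight `b(v)` with `∫ b dγ ≤ C σ^p/(N+1)`, for `σ < σ₀`, `N ≥ N₀(σ, τ)`, every ghost flow `Ψ` and enumeration
`emb`. A typed HYPOTHESIS of line `Sketch` of crux stmt-AtomisticToContinuum-14535 restated Theses-free for item
promotion (nothing is asserted; not a published fact). [folklore] -/
def FirstRungAt (θ₀ : ℝ) : Prop :=
  ∃ C : ℝ, 0 < C ∧ ∃ p : ℝ, 0 < p ∧ ∃ σ₀ : ℝ, 0 < σ₀ ∧ ∀ σ : ℝ, 0 < σ → σ < σ₀ →
  ∀ τ : ℝ, 0 < τ → ∃ N₀ : ℕ, ∀ N : ℕ, N₀ ≤ N →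
    ∀ Ψ : HardSphereFlow (Torus.geometry (Fin 3)) (hsDiameter σ N) (N - 1),
    ∀ (i j : Fin (N + 1)), j ≠ i →
    ∀ emb : Fin (N - 1) ↪ Fin (N + 1), (∀ k : Fin (N + 1), (∃ l, emb l = k) ↔ (k ≠ i ∧ k ≠ j)) →
    let G : Geometry (Fin 3) T3 := Torus.geometry (Fin 3)
    let ε : ℝ := hsDiameter σ N
    let w : ℝ := τ * ((N + 1 : ℕ) : ℝ) ^ (-(1 / 3 : ℝ))
    let q : T3 → (Fin 3 → ℤ) :=
      Torus.coarseCell ((Real.sqrt 2 * Real.pi * σ ^ 2)⁻¹ * ((N + 1 : ℕ) : ℝ) ^ (-(1 / 3 : ℝ)))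
    let μ : Measure (Fin (N + 1) → T3) := posGibbsMeasure (fun _ => 1) ε (N + 1)
    let γ : Measure (Fin (N + 1) → V3) := Measure.pi fun _ => gaussMeasure (0 : V3) θ₀
    let tE : Config (N + 1) (Fin 3) T3 → ℝ := fun z =>
      sInf {t : ℝ | 0 < t ∧ ‖(Torus.geometry (Fin 3)).sepVec (freeFlight (Torus.geometry (Fin 3)) t z i).1
        (freeFlight (Torus.geometry (Fin 3)) t z j).1‖ ≤ ε}
    let F : Set (Config (N + 1) (Fin 3) T3) :=
      {z | (z ∘ emb : Config (N - 1) (Fin 3) T3) ∈ Ψ.good ∧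
        sInf {t : ℝ | 0 < t ∧ ‖(Torus.geometry (Fin 3)).sepVec (freeFlight (Torus.geometry (Fin 3)) t z i).1
          (freeFlight (Torus.geometry (Fin 3)) t z j).1‖ ≤ hsDiameter σ N} ∈ Set.Ioc 0 w ∧
        ∀ u ∈ Set.Ioc 0 (sInf {t : ℝ | 0 < t ∧
          ‖(Torus.geometry (Fin 3)).sepVec (freeFlight (Torus.geometry (Fin 3)) t z i).1
            (freeFlight (Torus.geometry (Fin 3)) t z j).1‖ ≤ hsDiameter σ N}), ∀ k : Fin (N - 1),
          hsDiameter σ N < ‖(Torus.geometry (Fin 3)).sepVec (Ψ.flow u (z ∘ emb) k).1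
            (freeFlight (Torus.geometry (Fin 3)) u z i).1‖ ∧
          hsDiameter σ N < ‖(Torus.geometry (Fin 3)).sepVec (Ψ.flow u (z ∘ emb) k).1
            (freeFlight (Torus.geometry (Fin 3)) u z j).1‖}
    let ωPair : Config (N + 1) (Fin 3) T3 → V3 := fun z =>
      ε⁻¹ • G.sepVec (freeFlight G (tE z) z i).1 (freeFlight G (tE z) z j).1
    let flux : V3 → Set V3 → ℝ := fun g U =>
      ((∫⁻ ω, U.indicator (fun _ => (1 : ℝ≥0∞)) (ω : V3) * ENNReal.ofReal (max (-inner ℝ (ω : V3) g) 0)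
          ∂(sphereMeasure (E := V3))) /
        (∫⁻ ω, ENNReal.ofReal (max (-inner ℝ (ω : V3) g) 0) ∂(sphereMeasure (E := V3)))).toReal
    ∃ b : (Fin (N + 1) → V3) → ℝ, Integrable b γ ∧ ∫ v, b v ∂γ ≤ C * σ ^ p / (N + 1) ∧
      ∀ (v : Fin (N + 1) → V3) (U : Set V3), MeasurableSet U →
      ∀ T : Set (Fin (N + 1) → (Fin 3 → ℤ)), MeasurableSet T →
        |(μ {x | zipConfig (x, v) ∈ F ∧ ωPair (zipConfig (x, v)) ∈ U ∧ (fun k => q (x k)) ∈ T}).toReal -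
            flux (‖v i - v j‖⁻¹ • (v i - v j)) U *
              (μ {x | zipConfig (x, v) ∈ F ∧ (fun k => q (x k)) ∈ T}).toReal| ≤ b v

/-! ## Translation quasi-invariance on a regime -/

/-- **Translation quasi-invariance at temperature `θ₀` on the regime `X`, Theses-free** — the text of
`OLC.RegimeTransQuasiInvBody θ₀ X` (`∃ C p σ₀ > 0, ∀ σ ∈ (0, σ₀), OLC.RegimeTransQuasiInvTail θ₀ σ (C σ^p) X`) with the
tail inlined (its `let`s verbatim, bound `C σ^p`), `OLC.rhoStar σ` replaced by `(√2 π σ²)⁻¹` and the regime type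
`OLC.Regime` written out; so that `TransQuasiInvAt θ₀ X ↔ OLC.RegimeTransQuasiInvBody θ₀ X` is `Iff.rfl`
(`OLC.Inputs.transQuasiInvAt_iff`). Content: with `P` the global Gibbs law at activity `1`, temperature `θ₀`, `W` the
window event (`≥ n+1` collisions of `i` in `(0, τ (N+1)^{-1/3}]`), `ĝ` the incoming-direction proxy read from the coarse
past, `s⁺` the later flight start of `i` and its `n`-th partner, `b = ε⁻¹ (q − ⟪q, ĝ⟫ ĝ)` the transverse offset of the
pair at `s⁺`, `D g` the open unit disc of `g^⊥`, `pr g δ = δ − ⟪δ, g⟫ g`: for every shift `δ`, measurable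
`S ⊆ ℝ³ × ℝ³` and `E ∈ 𝒢 = comap (coarsePastOf q i n, nthPartnerOf i n)`,
`|P(W ∩ {(ĝ, b) ∈ S, b ∈ D ĝ, b − pr ĝ δ ∈ D ĝ} ∩ (X ∩ E)) − P(W ∩ {(ĝ, b + pr ĝ δ) ∈ S, b + pr ĝ δ ∈ D ĝ, b ∈ D ĝ} ∩ (X ∩ E))| ≤ C σ^p`
for `σ < σ₀`, `N ≥ N₀(σ, τ, n)`. A typed HYPOTHESIS frame of line `Sketch` of crux stmt-AtomisticToContinuum-14535
restated Theses-free for item promotion (nothing is asserted; not a published fact). [folklore] -/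
def TransQuasiInvAt (θ₀ : ℝ)
    (X : ∀ (σ : ℝ) (n N : ℕ), HardSphereFlow (Torus.geometry (Fin 3)) (hsDiameter σ N) (N + 1) → Fin (N + 1) →
      Set (Config (N + 1) (Fin 3) T3)) : Prop :=
  ∃ C : ℝ, 0 < C ∧ ∃ p : ℝ, 0 < p ∧ ∃ σ₀ : ℝ, 0 < σ₀ ∧ ∀ σ : ℝ, 0 < σ → σ < σ₀ →
  ∀ τ : ℝ, 0 < τ → ∀ n : ℕ, ∃ N₀ : ℕ, ∀ N : ℕ, N₀ ≤ N →
    ∀ Φ : HardSphereFlow (Torus.geometry (Fin 3)) (hsDiameter σ N) (N + 1),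
    ∀ (i : Fin (N + 1)) (δ : V3) (S : Set (V3 × V3)), MeasurableSet S →
    let G : Geometry (Fin 3) T3 := Torus.geometry (Fin 3)
    let ε : ℝ := hsDiameter σ N
    let w : ℝ := τ * ((N + 1 : ℕ) : ℝ) ^ (-(1 / 3 : ℝ))
    let q : T3 → (Fin 3 → ℤ) :=
      Torus.coarseCell ((Real.sqrt 2 * Real.pi * σ ^ 2)⁻¹ * ((N + 1 : ℕ) : ℝ) ^ (-(1 / 3 : ℝ)))
    let P : Measure (Config (N + 1) (Fin 3) T3) := localGibbsLaw σ (fun _ => 1) (fun _ => 0) (fun _ => θ₀) N Φ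
    let W : Set (Config (N + 1) (Fin 3) T3) :=
      {z | n + 1 ≤ Set.ncard (collisionTimesOf G ε (fun t => Φ.flow t z) i ∩ Set.Ioc 0 w)}
    let gIn : Config (N + 1) (Fin 3) T3 → V3 := fun z =>
      ‖((Φ.coarsePastOf q i n z).1 i).2 - ((Φ.coarsePastOf q i n z).2 (Φ.nthPartnerOf i n z)).2‖⁻¹ •
        (((Φ.coarsePastOf q i n z).1 i).2 - ((Φ.coarsePastOf q i n z).2 (Φ.nthPartnerOf i n z)).2)
    let sPlus : Config (N + 1) (Fin 3) T3 → ℝ := fun z =>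
      max (flightStart G ε (fun t => Φ.flow t z) 0 i (Φ.nthCollisionTimeOf i n z))
        (flightStart G ε (fun t => Φ.flow t z) 0 (Φ.nthPartnerOf i n z) (Φ.nthCollisionTimeOf i n z))
    let bOff : Config (N + 1) (Fin 3) T3 → V3 := fun z =>
      ε⁻¹ • (G.sepVec (Φ.flow (sPlus z) z i).1 (Φ.flow (sPlus z) z (Φ.nthPartnerOf i n z)).1 -
        inner ℝ (G.sepVec (Φ.flow (sPlus z) z i).1 (Φ.flow (sPlus z) z (Φ.nthPartnerOf i n z)).1) (gIn z) •
          gIn z)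
    let D : V3 → Set V3 := fun g => {u | inner ℝ u g = 0 ∧ ‖u‖ < 1}
    let pr : V3 → V3 → V3 := fun g δ' => δ' - inner ℝ δ' g • g
    ∀ E : Set (Config (N + 1) (Fin 3) T3),
      MeasurableSet[MeasurableSpace.comap (fun z => (Φ.coarsePastOf q i n z, Φ.nthPartnerOf i n z))
        inferInstance] E →
      |(P (W ∩ {z | (gIn z, bOff z) ∈ S ∧ bOff z ∈ D (gIn z) ∧ bOff z - pr (gIn z) δ ∈ D (gIn z)} ∩
            (X σ n N Φ i ∩ E))).toReal -
          (P (W ∩ {z | (gIn z, bOff z + pr (gIn z) δ) ∈ S ∧ bOff z + pr (gIn z) δ ∈ D (gIn z) ∧ bOff z ∈ D (gIn z)} ∩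
            (X σ n N Φ i ∩ E))).toReal| ≤ C * σ ^ p

/-! ## The three regimes and the three gap inputs -/

/-- **The short-gap regime, Theses-free** — the text of `OLC.shortGap θ₀ u₀` with the mean free time
`OLC.mfTime σ θ₀ N = (N+1)^{-1/3}/(σ² √θ₀)` inlined: for each `(σ, n, N, Φ, i)` the event
`{|s_i − s_j| ≤ u₀ · mfTime}` that the flight starts (from time `0`) of `i` and of its `n`-th partner before the `n`-th
collision time of `i` are at most `u₀` mean free times apart; `shortGapSet = OLC.shortGap` is `rfl`
(`OLC.Inputs.shortGapSet_eq`). Restated Theses-free for item promotion. [folklore] -/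
def shortGapSet (θ₀ u₀ : ℝ) :
    ∀ (σ : ℝ) (n N : ℕ), HardSphereFlow (Torus.geometry (Fin 3)) (hsDiameter σ N) (N + 1) → Fin (N + 1) →
      Set (Config (N + 1) (Fin 3) T3) := fun σ n N Φ i =>
  {z | |flightStart (Torus.geometry (Fin 3)) (hsDiameter σ N) (fun t => Φ.flow t z) 0 i (Φ.nthCollisionTimeOf i n z) -
        flightStart (Torus.geometry (Fin 3)) (hsDiameter σ N) (fun t => Φ.flow t z) 0 (Φ.nthPartnerOf i n z)
          (Φ.nthCollisionTimeOf i n z)| ≤ u₀ * (((N + 1 : ℕ) : ℝ) ^ (-(1 / 3 : ℝ)) / (σ ^ 2 * Real.sqrt θ₀))}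

/-- **Short-gap input at temperature `θ₀`, Theses-free** — translation quasi-invariance on the SHORT-GAP regime
`shortGap θ₀ (1/20) ∖ shortGap θ₀ 0 = {0 < |s_i − s_j| ≤ mfTime/20}`:
`TransQuasiInvAt θ₀ (shortGapSet θ₀ (1/20) ∩ (shortGapSet θ₀ 0)ᶜ)`, definitionally
`OLC.RegimeTransQuasiInvBody θ₀ ((OLC.shortGap θ₀ (1/20)).inter (OLC.shortGap θ₀ 0).compl)` (`OLC.Inputs.shortGapAt_iff`,
`Iff.rfl`); the second input of the line is `∀ θ₀ > 0, ShortGapAt θ₀` (the registered stub `stub_shortGap_tqi` of the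
skeleton `Lines/Sketch.lean`). A typed HYPOTHESIS of line `Sketch` of crux stmt-AtomisticToContinuum-14535 restated
Theses-free for item promotion (nothing is asserted; not a published fact). [folklore] -/
def ShortGapAt (θ₀ : ℝ) : Prop :=
  TransQuasiInvAt θ₀ (fun σ n N Φ i => shortGapSet θ₀ (1 / 20) σ n N Φ i ∩ (shortGapSet θ₀ 0 σ n N Φ i)ᶜ)

/-- **Long-gap input at temperature `θ₀`, Theses-free** — translation quasi-invariance on the LONG-GAP regime
`(shortGap θ₀ (1/20))ᶜ = {|s_i − s_j| > mfTime/20}`: `TransQuasiInvAt θ₀ (shortGapSet θ₀ (1/20))ᶜ`, definitionally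
`OLC.RegimeTransQuasiInvBody θ₀ (OLC.shortGap θ₀ (1/20)).compl` (`OLC.Inputs.longGapAt_iff`, `Iff.rfl`); the third input
of the line is `∀ θ₀ > 0, LongGapAt θ₀` (the registered stub `stub_longGap_tqi` of the skeleton `Lines/Sketch.lean`).
A typed HYPOTHESIS of line `Sketch` of crux stmt-AtomisticToContinuum-14535 restated Theses-free for item promotion
(nothing is asserted; not a published fact). [folklore] -/
def LongGapAt (θ₀ : ℝ) : Prop :=
  TransQuasiInvAt θ₀ (fun σ n N Φ i => (shortGapSet θ₀ (1 / 20) σ n N Φ i)ᶜ)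

/-- **Nonzero-gap input at temperature `θ₀`, Theses-free** (the two gap inputs merged) — translation
quasi-invariance on the NONZERO-GAP regime `(shortGap θ₀ 0)ᶜ = {s_i ≠ s_j}`: `TransQuasiInvAt θ₀ (shortGapSet θ₀ 0)ᶜ`,
definitionally `OLC.RegimeTransQuasiInvBody θ₀ (OLC.shortGap θ₀ 0).compl` (`OLC.Inputs.nonzeroGapAt_iff`, `Iff.rfl`);
`∀ θ₀ > 0, NonzeroGapAt θ₀` is the second hypothesis of the two-input glue `OLC.oneFlightLayeredChaos_of_two_inputs`
(the cut of the nonzero-gap event at `mfTime/20` in the three-input form is a choice of the line, not of the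
mathematics). A typed HYPOTHESIS of line `Sketch` of crux stmt-AtomisticToContinuum-14535 restated Theses-free for
item promotion (nothing is asserted; not a published fact). [folklore] -/
def NonzeroGapAt (θ₀ : ℝ) : Prop :=
  TransQuasiInvAt θ₀ (fun σ n N Φ i => (shortGapSet θ₀ 0 σ n N Φ i)ᶜ)

/-! ## Carrier theorem -/

/-- **The short-gap regimes are nested in the cut**: `shortGapSet θ₀ u₀ ⊆ shortGapSet θ₀ u₁` pointwise for `u₀ ≤ u₁`
(the inlined mean free time `(N+1)^{-1/3}/(σ² √θ₀)` is `≥ 0` for every `σ, θ₀, N` — a quotient of nonnegative reals,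
junk `0` included); in particular the same-start event `shortGapSet θ₀ 0` lies in every `shortGapSet θ₀ c`, `c ≥ 0`,
the nesting used by the split of the nonzero-gap regime (`OLC.shortGap_inter_shortGap_zero`). Registered stub
`shortGapSet_mono` of crux stmt-AtomisticToContinuum-14535, line `Sketch`, brick B4 (the file's carrier theorem).
[folklore] -/
theorem shortGapSet_mono : ∀ (θ₀ : ℝ) {u₀ u₁ : ℝ}, u₀ ≤ u₁ → ∀ (σ : ℝ) (n N : ℕ) (Φ : Literature.Analysis.FluidPDE.HardSphereFlow (Literature.Analysis.FluidPDE.Torus.geometry (Fin 3)) (Literature.MathematicalPhysics.KineticTheory.hsDiameter σ N) (N + 1)) (i : Fin (N + 1)), Summit.AtomisticToContinuum.HydrodynamicLimit.Theorems.OLC.Inputs.shortGapSet θ₀ u₀ σ n N Φ i ⊆ Summit.AtomisticToContinuum.HydrodynamicLimit.Theorems.OLC.Inputs.shortGapSet θ₀ u₁ σ n N Φ i := by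
  intro θ₀ u₀ u₁ hu σ n N Φ i z hz
  have hm : 0 ≤ ((N + 1 : ℕ) : ℝ) ^ (-(1 / 3 : ℝ)) / (σ ^ 2 * Real.sqrt θ₀) :=
    div_nonneg (Real.rpow_nonneg (Nat.cast_nonneg _) _) (mul_nonneg (sq_nonneg σ) (Real.sqrt_nonneg θ₀))
  exact le_trans (b := u₀ * (((N + 1 : ℕ) : ℝ) ^ (-(1 / 3 : ℝ)) / (σ ^ 2 * Real.sqrt θ₀))) hz
    (mul_le_mul_of_nonneg_right hu hm)

end

end Summit.AtomisticToContinuum.HydrodynamicLimit.Theorems.OLC.Inputs
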